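import Literature.IUT.HodgeTheaters.Cor53iFcircBijectiveAtOpenEmbedding
import HarnessLib

/-!
# Layer-5 certificate v0.27 — BLOCK K over BUILT Literature modules only: [IUTchI] Cor 5.3 (i) «respectively `⊚`» AS PRINTED
# («bijective») at the push carrier of EVERY OPEN EMBEDDING `ι : H ↪ G_F` — modulo the NAMED FACT {`NeukirchUchida F`}, with the
# SIDE-EXTRA hypothesis {`Normal ℚ F`} (NOT a [IUTchI] Def 3.1 clause) and the carrier data {`hc`, `ho`, `hinj`} displayed
# (abc-iut-L5-lead gen 11 RULINGS #216 «V27 (t16 g13, pre-approved shape)»; CERT-L5 R73 holder abc-iut-L5-t16 gen 13;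
# plan/L5/LAYER5-CERT-SPEC.md §7)

PROOF-ONLY (no `def`, no `instance`, no `axiom`, no `sorry`, no `notation`); NO `Conditional` import (architecture-neutral).  The one
theorem is a landed Literature theorem VERBATIM (section variables spelled in), proof BY NAME — one call, from abc-iut-L5-t4's
row «HDESC@OPEN-EMBEDDING mod NU»: FILE 2 ★ p553146 `Cor53iFcircBijectiveAtOpenEmbedding` over FILE 1 ★ p552162
`Cor53iFcircHdescOfAutCompatible` (the descent law `hdesc⊚` at a push carrier ⟸ the automorphism-compatibility law `AutCompatible ι`;
that law DISCHARGED for open EMBEDDINGS from `NeukirchUchida F` + «`F/ℚ` normal»; then abc-iut-w4-d109's `hlift⊚` by name and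
abc-iut-L5-t11's ★ p542877 `Cor53.fcirc_descendBijective_of_galoisRich_of_lifts` with `hS` := abc-iut-L5-t4's ★ p545785):
* (C-53i⊚-bij@open-emb) `layer5_disch_cor53i_v27_fcirc_descendBijective_openEmbedding (F) (hNU) (H) (ι) (hc) (ho) (hinj) (𝓕)` :=
  `Cor53.fcirc_descendBijective_of_openEmbedding_of_neukirchUchida`: for EVERY profinite `H`, EVERY continuous open injective
  `ι : H →* G_F` (the class of print's `π₁(†𝒟^⊚) ↪ π₁(†𝒟^⊛)`, [IUTchI] Ex 5.1 (i)) and EVERY record `𝓕` over the push carrier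
  `ℬ(H)⁰ → CosetCat H → CosetCat G_F → ℬ(G_F)⁰`, the §0 map `Aut(†ℱ^⊚) → Aut(†𝒟^⊚)` is BIJECTIVE — DISPLAYED binders exactly
  {`hNU : NeukirchUchida F`} (FACT, BY NAME: [NSW] Thm (12.2.1)) + {`[Normal ℚ F]`} (SIDE-EXTRA, labelled: NOT in [IUTchI] Def 3.1) +
  carrier data {`hc`, `ho`, `hinj`}; LAW ∅ (`hZ` from `G_F` slim + `ι` injective open; `AutCompatible ι`, `hdesc⊚`, `hlift⊚`, `hS`, `hB⊚`
  all discharged inside FILES 1–2);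
* (not displayed) the push-autCompatible form ★ p552162 `Cor53.fcirc_descendBijective_of_pushCarrier_of_autCompatible_of_neukirchUchida`
  ({`hNU`} FACT + {`hZ`, `SecondCountableTopology H`} side + LAW {`hAE` = `AutCompatible ι`}; the optional second conjunct of RULINGS #216/#217)
  is CITED BY NAME only: a verbatim display of it is refused by the gate's `dedup.landed` lint (dry-runs 18:27:40Z / 18:29:03Z), so
  BLOCK K carries ONE conjunct.
HONEST NOTE (RULINGS #173 (3) / #193 (1) / #199 / #204, of record): at a DEGENERATE (constant) carrier hB⊚ is refutable-as-typed and
`hS` is EMPTY (★ p549132); at a general NON-injective push carrier the law `hAE` stays displayed (no witness filed either way); the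
push carrier of an open embedding is OUR model of print's `†𝒟^⊚ → †𝒟^⊛`.  CENSUS delta for §7 (the lead's booking): display: +1
conjunct (C-53i⊚-bij@open-emb) with binder set {hNU} ∪ SIDE-EXTRA {Normal ℚ F} ∪ data {hc, ho, hinj}; FACT column unchanged (hNU
already counted via (C-53i⊛) at v0.23); tokens none.
S. Mochizuki, *Inter-universal Teichmüller theory I* [cite: Mochizuki2012] (D-0012 claim key; series status DISPUTED): Cor 5.3 (i) p. 144;
Ex 5.1 (i)/(iii)/(v) pp. 123–128.  HONEST FRAMING: a CERT conjunct DISPLAYS its binders, it does not discharge them; `NeukirchUchida F`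
is a NAMED FACT, unproved in the tree; nothing here asserts that abc is proved or refuted or takes a side on [IUTchIII] Cor. 3.12;
typed ≠ inhabited ≠ discharged; indexed ≠ endorsed.
-/

namespace Summit.ABC.IUTFork.Conditional

open CategoryTheory Opposite Function Literature.IUT.HodgeTheaters
open Literature.AnabelianGeometry.SemiGraphs Literature.AlgebraicGeometry.Frobenioids
open Literature.AlgebraicGeometry.Frobenioids.QuasiTemperoid Literature.NumberTheory.GaloisRepresentations

noncomputable section BlocksKV27

/-- **(C-53i⊚-bij@open-emb) [IUTchI] Cor 5.3 (i) «resp. `⊚`» AS PRINTED («bijective») at the push carrier of EVERY open embedding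
`ι : H ↪ G_F`, for EVERY record, modulo {`NeukirchUchida F`} + SIDE-EXTRA {`Normal ℚ F`}** := abc-iut-L5-t4's ★
`Cor53.fcirc_descendBijective_of_openEmbedding_of_neukirchUchida` (p553146).  DISPLAYED binders exactly {`hNU`} (FACT) + {`[Normal ℚ F]`}
(SIDE-EXTRA, NOT a [IUTchI] Def 3.1 clause) + carrier data {`hc`, `ho`, `hinj`}; LAW ∅.
[cite: Mochizuki2012, IUTchI Cor 5.3 (i) p.144] [claim: Mochizuki2012, status: disputed] -/
theorem layer5_disch_cor53i_v27_fcirc_descendBijective_openEmbedding (F : Type) [Field F] [NumberField F] [Normal ℚ F]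
    (hNU : NeukirchUchida F) (H : ProfiniteGrp.{0}) (ι : H →* GalFbar F) (hc : Continuous ι) (ho : IsOpenMap ι) (hinj : Injective ι)
    (𝓕 : GlobalFrobenioid (GlobalDivisorData.arith F) (BaseCat H)
      (baseToCoset H ⋙ CosetCat.push ι ho ⋙ cosetToBase (absGalGrp F))) :
    CatIsomorphism.DescendBijective 𝓕.fcircBase 𝓕.fcircBase
      (GlobalFrobenioid.hasUnder_and_underUnique_fcircBase_arith_baseCat 𝓕 𝓕
        (isSlimGroup_of_injective_of_isOpenMap ι ho hinj (isSlimGroup_absGalGrp F))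
        (isSlimGroup_of_injective_of_isOpenMap ι ho hinj (isSlimGroup_absGalGrp F))).1
      (GlobalFrobenioid.hasUnder_and_underUnique_fcircBase_arith_baseCat 𝓕 𝓕
        (isSlimGroup_of_injective_of_isOpenMap ι ho hinj (isSlimGroup_absGalGrp F))
        (isSlimGroup_of_injective_of_isOpenMap ι ho hinj (isSlimGroup_absGalGrp F))).2 :=
  Cor53.fcirc_descendBijective_of_openEmbedding_of_neukirchUchida F hNU H ι hc ho hinj 𝓕

end BlocksKV27

end Summit.ABC.IUTFork.Conditional

/-! ### Build-lane export guard (ops-buildfix bf1-g30, 2026-08-28; G11b-3 recipe v2 as in `GelbartRogawski1991/UnitaryDualPairSeesawCharacter`):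
the theorems of this file carry very large dependent telescopes; at `.olean` export Lean 4.32's library-suggestion indexers fold over
every local theorem statement and do not finish within the build lane's one-hour clock (measured on a farm node: `lean -o` > 1 500 s, plain
elaboration ≈ 20 s). ONE file-final `local` `[implicit_reducible]` keeps them out of that premise index (inert for Meta and the kernel on
theorems; no definition is tagged; statements and proofs unchanged). -/
set_option allowUnsafeReducibility true in
attribute [local implicit_reducible]
  _root_.Summit.ABC.IUTFork.Conditional.layer5_disch_cor53i_v27_fcirc_descendBijective_openEmbedding
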